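import Mathlib
import Summits.Ventures.PercRepro2.Defs
import Summits.Ventures.PercRepro2.Harris
import Summits.Ventures.PercRepro2.TReduction
import Summits.Ventures.PercRepro2.TReductionBase

/-!
# The uniform 2-colouring of `D` as a product measure, and the antipodal Harris form
(blind cell PercRepro2, mine-a g42)

At an antipodal base case of `TReduction` (weights `a` that are `0/1`-valued off `D`) the sum over
the configurations supported on `D` is the expectation under the product weights
`halfWeights a D` = `1/2` on `D`, `a` elsewhere (`expect_halfWeights_eq_sum`):

  `E_{halfWeights a D}[φ(c_ω)] = (1/2)^|D| Σ_{σ supported on D} φ(c_σ)`, `c_σ = baseConfig a D σ`.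

These weights are invariant under the flip of the edges of `D` (`flipEdges`), which carries the
base configuration to its antipode, so Harris–FKG for the weights `halfWeights a D` gives the
**antipodal Harris form** (`antipodal_sum_nonneg_of_isUpperSet`): for increasing events `U e`,

  `Σ_{σ supported on D} (1_U(c_σ) − 1_U(c_σ̄)) (1_e(c_σ) − 1_e(c_σ̄)) ≥ 0`,

the case `Q = univ` of the cell's uniform 2-colouring inequality (K₀⁰) (MINE-A.md §96):
`E[(F − F̄)(G − Ḡ)] = 2E[FG] − E[F Ḡ] − E[F̄ G] ≥ 2E[F]E[G] − 2E[F]E[G] = 0` with `F̄ = F ∘ flip`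
decreasing.  Used by `TMonoH.lean` for the terminal case of the induction on the edges at `h`.
No instance, no notation.
-/

namespace Summit.Ventures.PercRepro2

namespace TReduction

open Finset

/-! ## The uniform colouring of `D` as a product measure -/

section HalfWeights

variable {E : Type*} [Fintype E] [DecidableEq E] {R : Type*} [Field R] [LinearOrder R]
  [IsStrictOrderedRing R]

/-- The weights `1/2` on the edges of `D` and `a` elsewhere: the uniform 2-colouring of `D` at the
base case `a`. -/
def halfWeights (a : E → R) (D : Finset E) : E → R := fun x => if x ∈ D then (1 / 2 : R) else a x

omit [Fintype E] [LinearOrder R] [IsStrictOrderedRing R] in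
/-- `halfWeights` on `D`. -/
lemma halfWeights_of_mem (a : E → R) {D : Finset E} {x : E} (hx : x ∈ D) :
    halfWeights a D x = 1 / 2 := by
  simp [halfWeights, hx]

omit [Fintype E] [LinearOrder R] [IsStrictOrderedRing R] in
/-- `halfWeights` off `D`. -/
lemma halfWeights_of_not_mem (a : E → R) {D : Finset E} {x : E} (hx : x ∉ D) :
    halfWeights a D x = a x := by
  simp [halfWeights, hx]

omit [Fintype E] [LinearOrder R] [IsStrictOrderedRing R] in
/-- `halfWeights` over the empty set is `a`. -/
lemma halfWeights_empty (a : E → R) : halfWeights a ∅ = a := by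
  ext x; simp [halfWeights]

omit [Fintype E] [LinearOrder R] [IsStrictOrderedRing R] in
/-- `halfWeights a (insert x D)` is `halfWeights (a[x ↦ v]) D` with `x` re-pinned to `1/2`. -/
lemma halfWeights_insert_eq_update (a : E → R) {D : Finset E} {x : E} (hx : x ∉ D) (v : R) :
    halfWeights a (insert x D) =
      Function.update (halfWeights (Function.update a x v) D) x (1 / 2) := by
  ext y
  by_cases hy : y = x
  · subst hy; simp [halfWeights]
  · by_cases hyD : y ∈ D
    · simp [halfWeights, hyD, hy]
    · simp [halfWeights, hyD, hy]

omit [Fintype E] [IsStrictOrderedRing R] in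
/-- The base configuration of `insert x D` at a configuration open at `x` is the base configuration
of `D` at `a[x ↦ 1]`. -/
lemma baseConfig_insert_update_true (a : E → R) {D : Finset E} {x : E} (hx : x ∉ D)
    (ω : Config E) :
    baseConfig a (insert x D) (Function.update ω x true) =
      baseConfig (Function.update a x 1) D ω := by
  funext y
  by_cases hy : y = x
  · subst hy; simp [baseConfig, hx]
  · by_cases hyD : y ∈ D
    · simp [baseConfig, hyD, hy]
    · simp [baseConfig, hyD, hy]

omit [Fintype E] [IsStrictOrderedRing R] in
/-- The base configuration of `insert x D` at a configuration closed at `x` is the base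
configuration of `D` at `a[x ↦ 0]`. -/
lemma baseConfig_insert_update_false (a : E → R) {D : Finset E} {x : E} (hx : x ∉ D)
    (ω : Config E) :
    baseConfig a (insert x D) (Function.update ω x false) =
      baseConfig (Function.update a x 0) D ω := by
  funext y
  by_cases hy : y = x
  · subst hy; simp [baseConfig, hx]
  · by_cases hyD : y ∈ D
    · simp [baseConfig, hyD, hy]
    · simp [baseConfig, hyD, hy]

omit [Fintype E] [LinearOrder R] [IsStrictOrderedRing R] in
/-- A configuration closed at `x` is its own update at `x` to `false`. -/
lemma update_false_self_of_eq_false {ω : Config E} {x : E} (h : ω x = false) :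
    Function.update ω x false = ω := by
  funext y
  by_cases hy : y = x
  · subst hy; simp [h]
  · simp [Function.update_of_ne hy]

omit [Fintype E] [IsStrictOrderedRing R] in
/-- The base configuration over the empty set is `detConfig a`. -/
lemma baseConfig_empty (a : E → R) (σ : Config E) : baseConfig a ∅ σ = detConfig a := by
  funext y; simp [baseConfig, detConfig]

omit [LinearOrder R] [IsStrictOrderedRing R] in
/-- The only configuration supported on `∅` is the closed one. -/
lemma suppOn_empty : suppOn (∅ : Finset E) = {fun _ => false} := by
  ext σ
  simp only [mem_suppOn, notMem_empty, not_false_eq_true, true_implies, mem_singleton]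
  constructor
  · intro h; funext x; exact h x
  · intro h x; rw [h]

omit [LinearOrder R] [IsStrictOrderedRing R] in
/-- The expectation of an observable ignoring the edge `x` does not see the weight of `x`. -/
lemma expect_update_of_ignores (q : E → R) {f : Config E → R} {x : E}
    (hf : ∀ (ω : Config E) (b : Bool), f (Function.update ω x b) = f ω) (v : R) :
    expect (Function.update q x v) f = expect q f := by
  have e1 : (fun ω : Config E => f (Function.update ω x true)) = f := funext fun ω => hf ω true
  have e0 : (fun ω : Config E => f (Function.update ω x false)) = f := funext fun ω => hf ω false
  rw [expect_eq_pin (Function.update q x v) f x, Function.update_idem, Function.update_idem,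
    expect_update_one, expect_update_zero, e1, e0, Function.update_self]
  ring

/-- **The uniform colouring of `D` is the product measure `halfWeights a D`**: for `a` `0/1`-valued
off `D` and any `φ`, `E_{halfWeights a D}[φ(c_ω)] = (1/2)^|D| Σ_{σ supported on D} φ(c_σ)`. -/
theorem expect_halfWeights_eq_sum (φ : Config E → R) :
    ∀ (D : Finset E) (a : E → R), (∀ x, x ∉ D → a x = 0 ∨ a x = 1) →
      expect (halfWeights a D) (fun ω => φ (baseConfig a D ω)) =
        (1 / 2 : R) ^ D.card * ∑ σ ∈ suppOn D, φ (baseConfig a D σ) := by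
  intro D
  induction D using Finset.induction_on with
  | empty =>
    intro a ha
    rw [halfWeights_empty, suppOn_empty, sum_singleton, card_empty, pow_zero, one_mul]
    have hconst : (fun ω => φ (baseConfig a ∅ ω)) = fun _ => φ (detConfig a) := by
      funext ω; rw [baseConfig_empty]
    rw [hconst, expect_const, baseConfig_empty]
  | insert x D hx ih =>
    intro a ha
    have ha1 : ∀ y, y ∉ D → Function.update a x 1 y = 0 ∨ Function.update a x 1 y = 1 := by
      intro y hy
      by_cases hyx : y = x
      · subst hyx; simp
      · rw [Function.update_of_ne hyx]; exact ha y (by simp [hyx, hy])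
    have ha0 : ∀ y, y ∉ D → Function.update a x 0 y = 0 ∨ Function.update a x 0 y = 1 := by
      intro y hy
      by_cases hyx : y = x
      · subst hyx; simp
      · rw [Function.update_of_ne hyx]; exact ha y (by simp [hyx, hy])
    have hign1 : ∀ (ω : Config E) (b : Bool),
        φ (baseConfig (Function.update a x 1) D (Function.update ω x b)) =
          φ (baseConfig (Function.update a x 1) D ω) := by
      intro ω b; congr 1; funext y
      by_cases hyx : y = x
      · subst hyx; simp [baseConfig, hx]
      · simp [baseConfig, Function.update_of_ne hyx]
    have hign0 : ∀ (ω : Config E) (b : Bool),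
        φ (baseConfig (Function.update a x 0) D (Function.update ω x b)) =
          φ (baseConfig (Function.update a x 0) D ω) := by
      intro ω b; congr 1; funext y
      by_cases hyx : y = x
      · subst hyx; simp [baseConfig, hx]
      · simp [baseConfig, Function.update_of_ne hyx]
    have hL1 : expect (halfWeights a (insert x D))
          (fun ω => φ (baseConfig (Function.update a x 1) D ω)) =
        expect (halfWeights (Function.update a x 1) D)
          (fun ω => φ (baseConfig (Function.update a x 1) D ω)) := by
      rw [halfWeights_insert_eq_update a hx 1, expect_update_of_ignores _ hign1]
    have hL0 : expect (halfWeights a (insert x D))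
          (fun ω => φ (baseConfig (Function.update a x 0) D ω)) =
        expect (halfWeights (Function.update a x 0) D)
          (fun ω => φ (baseConfig (Function.update a x 0) D ω)) := by
      rw [halfWeights_insert_eq_update a hx 0, expect_update_of_ignores _ hign0]
    -- left side: pin `x`
    have h12 : (1 : R) - 1 / 2 = 1 / 2 := by norm_num
    rw [expect_eq_pin _ _ x, halfWeights_of_mem a (mem_insert_self x D), h12, expect_update_one,
      expect_update_zero]
    simp only [baseConfig_insert_update_true a hx, baseConfig_insert_update_false a hx]
    rw [hL1, hL0, ih _ ha1, ih _ ha0]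
    -- right side: split the support at `x`
    rw [← sum_filter_add_sum_filter_not (suppOn (insert x D)) (fun σ => σ x = true)]
    have hnot : (suppOn (insert x D)).filter (fun σ => ¬ σ x = true) =
        (suppOn (insert x D)).filter (fun σ => σ x = false) := by
      apply filter_congr; intro σ _; simp
    rw [hnot, suppOn_insert_filter_false hx, suppOn_insert_filter_true hx,
      sum_image (update_true_injOn hx)]
    have h1 : ∑ σ ∈ suppOn D, φ (baseConfig a (insert x D) (Function.update σ x true)) =
        ∑ σ ∈ suppOn D, φ (baseConfig (Function.update a x 1) D σ) :=
      sum_congr rfl fun σ _ => by rw [baseConfig_insert_update_true a hx]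
    have h0 : ∑ σ ∈ suppOn D, φ (baseConfig a (insert x D) σ) =
        ∑ σ ∈ suppOn D, φ (baseConfig (Function.update a x 0) D σ) :=
      sum_congr rfl fun σ hσ => by
        rw [← baseConfig_insert_update_false a hx,
          update_false_self_of_eq_false ((mem_suppOn.1 hσ) x hx)]
    rw [h1, h0, card_insert_of_notMem hx, pow_succ]
    ring

end HalfWeights

/-! ## The antipode of `D` and the Harris form -/

section Antipode

variable {E : Type*} [Fintype E] [DecidableEq E] {R : Type*} [Field R] [LinearOrder R]
  [IsStrictOrderedRing R]

/-- Flipping the states of the edges of `D`. -/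
def flipEdges (D : Finset E) (ω : Config E) : Config E := fun x => if x ∈ D then !ω x else ω x

omit [Fintype E] [LinearOrder R] [IsStrictOrderedRing R] in
/-- `flipEdges D` is an involution. -/
lemma flipEdges_involutive (D : Finset E) : Function.Involutive (flipEdges D) := by
  intro ω; funext x; by_cases hx : x ∈ D <;> simp [flipEdges, hx]

omit [Fintype E] [IsStrictOrderedRing R] in
/-- The antipode of a base configuration is its flip on `D`. -/
lemma baseConfig_not_eq_flipEdges (a : E → R) (D : Finset E) (σ : Config E) :
    baseConfig a D (fun x => !σ x) = flipEdges D (baseConfig a D σ) := by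
  funext x; by_cases hx : x ∈ D <;> simp [baseConfig, flipEdges, hx]

omit [Fintype E] [IsStrictOrderedRing R] in
/-- A base configuration evaluated at a flipped configuration is its flip. -/
lemma baseConfig_flipEdges (a : E → R) (D : Finset E) (ω : Config E) :
    baseConfig a D (flipEdges D ω) = baseConfig a D (fun x => !ω x) := by
  funext x; by_cases hx : x ∈ D <;> simp [baseConfig, flipEdges, hx]

/-- The weights `halfWeights a D` are invariant under the flip of `D`. -/
lemma weight_halfWeights_flipEdges (a : E → R) (D : Finset E) (ω : Config E) :
    weight (halfWeights a D) (flipEdges D ω) = weight (halfWeights a D) ω := by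
  unfold weight
  refine prod_congr rfl fun x _ => ?_
  by_cases hx : x ∈ D
  · rw [halfWeights_of_mem a hx]
    have hflip : flipEdges D ω x = !ω x := by simp [flipEdges, hx]
    rw [hflip]
    cases ω x <;> simp [edgeFactor] <;> norm_num
  · simp [flipEdges, hx]

/-- Expectations under `halfWeights a D` are invariant under the flip of `D`. -/
lemma expect_halfWeights_comp_flipEdges (a : E → R) (D : Finset E) (f : Config E → R) :
    expect (halfWeights a D) (fun ω => f (flipEdges D ω)) = expect (halfWeights a D) f := by
  unfold expect
  rw [← Equiv.sum_comp (Function.Involutive.toPerm (flipEdges D) (flipEdges_involutive D))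
    (fun ω => weight (halfWeights a D) ω * f ω)]
  refine sum_congr rfl fun ω _ => ?_
  simp only [Function.Involutive.coe_toPerm]
  rw [weight_halfWeights_flipEdges]

omit [Fintype E] [IsStrictOrderedRing R] in
/-- The base configuration is monotone in the configuration. -/
lemma monotone_baseConfig (a : E → R) (D : Finset E) : Monotone (baseConfig a D) := by
  intro ω ω' h x
  by_cases hx : x ∈ D
  · simp only [baseConfig, hx, if_true]; exact h x
  · simp [baseConfig, hx]

omit [Fintype E] [IsStrictOrderedRing R] in
/-- The base configuration of the antipode is antitone in the configuration. -/
lemma antitone_baseConfig_not (a : E → R) (D : Finset E) :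
    Antitone (fun ω : Config E => baseConfig a D fun x => !ω x) := by
  intro ω ω' h x
  by_cases hx : x ∈ D
  · simp only [baseConfig, hx, if_true]
    have := h x
    cases hω : ω x <;> cases hω' : ω' x <;> simp_all
  · simp [baseConfig, hx]

omit [LinearOrder R] [IsStrictOrderedRing R] in
/-- Expectation of a negated observable. -/
lemma expect_neg (p : E → R) (f : Config E → R) : expect p (fun ω => -f ω) = -expect p f := by
  have := expect_const_mul p (-1) f
  simp only [neg_one_mul] at this
  exact this

/-- **The antipodal Harris form is nonnegative**: for increasing events `U e` and a base case `a`,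
`Σ_{σ supported on D} (1_U(c_σ) − 1_U(c_σ̄))(1_e(c_σ) − 1_e(c_σ̄)) ≥ 0`. -/
theorem antipodal_sum_nonneg_of_isUpperSet {U e : Set (Config E)} (hU : IsUpperSet U)
    (he : IsUpperSet e) {D : Finset E} {a : E → R} (ha0 : IsProbVec a)
    (ha : ∀ x, x ∉ D → a x = 0 ∨ a x = 1) :
    0 ≤ ∑ σ ∈ suppOn D,
      (U.indicator (fun _ => (1 : R)) (baseConfig a D σ)
          - U.indicator (fun _ => (1 : R)) (baseConfig a D fun x => !σ x))
        * (e.indicator (fun _ => (1 : R)) (baseConfig a D σ)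
          - e.indicator (fun _ => (1 : R)) (baseConfig a D fun x => !σ x)) := by
  -- the observables
  set F : Config E → R := fun ω => U.indicator (fun _ => (1 : R)) (baseConfig a D ω) with hF
  set F' : Config E → R := fun ω => U.indicator (fun _ => (1 : R)) (baseConfig a D fun x => !ω x)
    with hF'
  set G : Config E → R := fun ω => e.indicator (fun _ => (1 : R)) (baseConfig a D ω) with hG
  set G' : Config E → R := fun ω => e.indicator (fun _ => (1 : R)) (baseConfig a D fun x => !ω x)
    with hG'
  set q : E → R := halfWeights a D with hq
  have hq0 : IsProbVec q := by
    refine ⟨fun x => ?_, fun x => ?_⟩ <;> by_cases hx : x ∈ D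
    · rw [hq, halfWeights_of_mem a hx]; norm_num
    · rw [hq, halfWeights_of_not_mem a hx]; exact ha0.nonneg x
    · rw [hq, halfWeights_of_mem a hx]; norm_num
    · rw [hq, halfWeights_of_not_mem a hx]; exact ha0.le_one x
  -- the sum is the expectation of the product, up to the factor `(1/2)^|D|`
  have hsum : expect q (fun ω => (F ω - F' ω) * (G ω - G' ω)) =
      (1 / 2 : R) ^ D.card * ∑ σ ∈ suppOn D,
        (U.indicator (fun _ => (1 : R)) (baseConfig a D σ)
            - U.indicator (fun _ => (1 : R)) (baseConfig a D fun x => !σ x))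
          * (e.indicator (fun _ => (1 : R)) (baseConfig a D σ)
            - e.indicator (fun _ => (1 : R)) (baseConfig a D fun x => !σ x)) := by
    have := expect_halfWeights_eq_sum
      (fun c => (U.indicator (fun _ => (1 : R)) c - U.indicator (fun _ => (1 : R)) (flipEdges D c))
        * (e.indicator (fun _ => (1 : R)) c - e.indicator (fun _ => (1 : R)) (flipEdges D c)))
      D a ha
    simp only [← baseConfig_not_eq_flipEdges] at this
    exact this
  -- monotonicity of the observables
  have hFm : Monotone F := (monotone_indicator_of_isUpperSet (R := R) hU).comp (monotone_baseConfig a D)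
  have hGm : Monotone G := (monotone_indicator_of_isUpperSet (R := R) he).comp (monotone_baseConfig a D)
  have hF'a : Antitone F' :=
    (monotone_indicator_of_isUpperSet (R := R) hU).comp_antitone (antitone_baseConfig_not a D)
  have hG'a : Antitone G' :=
    (monotone_indicator_of_isUpperSet (R := R) he).comp_antitone (antitone_baseConfig_not a D)
  -- the flip symmetry
  have hFF' : F' = fun ω => F (flipEdges D ω) := by
    funext ω
    show U.indicator (fun _ => (1 : R)) (baseConfig a D fun x => !ω x) =
      U.indicator (fun _ => (1 : R)) (baseConfig a D (flipEdges D ω))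
    rw [baseConfig_flipEdges]
  have hGG' : G' = fun ω => G (flipEdges D ω) := by
    funext ω
    show e.indicator (fun _ => (1 : R)) (baseConfig a D fun x => !ω x) =
      e.indicator (fun _ => (1 : R)) (baseConfig a D (flipEdges D ω))
    rw [baseConfig_flipEdges]
  have hEF' : expect q F' = expect q F := by rw [hFF', hq, expect_halfWeights_comp_flipEdges]
  have hEG' : expect q G' = expect q G := by rw [hGG', hq, expect_halfWeights_comp_flipEdges]
  have hEFG' : expect q (fun ω => F' ω * G' ω) = expect q (fun ω => F ω * G ω) := by
    rw [hFF', hGG', hq]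
    exact expect_halfWeights_comp_flipEdges a D (fun ω => F ω * G ω)
  -- Harris
  have h1 : expect q F * expect q G ≤ expect q (fun ω => F ω * G ω) :=
    expect_mul_expect_le_expect_mul hq0 hFm hGm
  have h2 : expect q (fun ω => F ω * G' ω) ≤ expect q F * expect q G' := by
    have hneg : Monotone (fun ω => -G' ω) := fun ω ω' h => neg_le_neg (hG'a h)
    have := expect_mul_expect_le_expect_mul hq0 hFm hneg
    change expect q F * expect q (fun ω => -G' ω) ≤ expect q (fun ω => F ω * -G' ω) at this
    rw [expect_neg] at this
    have h' : expect q (fun ω => F ω * -G' ω) = -expect q (fun ω => F ω * G' ω) := by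
      rw [← expect_neg]; congr 1; funext ω; ring
    rw [h'] at this
    linarith
  have h3 : expect q (fun ω => F' ω * G ω) ≤ expect q F' * expect q G := by
    have hneg : Monotone (fun ω => -F' ω) := fun ω ω' h => neg_le_neg (hF'a h)
    have := expect_mul_expect_le_expect_mul hq0 hneg hGm
    change expect q (fun ω => -F' ω) * expect q G ≤ expect q (fun ω => -F' ω * G ω) at this
    rw [expect_neg] at this
    have h' : expect q (fun ω => -F' ω * G ω) = -expect q (fun ω => F' ω * G ω) := by
      rw [← expect_neg]; congr 1; funext ω; ring
    rw [h'] at this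
    linarith
  -- expand the product
  have hexp : expect q (fun ω => (F ω - F' ω) * (G ω - G' ω)) =
      expect q (fun ω => F ω * G ω) - expect q (fun ω => F ω * G' ω)
        - expect q (fun ω => F' ω * G ω) + expect q (fun ω => F' ω * G' ω) := by
    have hfun : (fun ω => (F ω - F' ω) * (G ω - G' ω)) =
        (fun ω => F ω * G ω) - (fun ω => F ω * G' ω) - (fun ω => F' ω * G ω)
          + (fun ω => F' ω * G' ω) := by
      funext ω; simp only [Pi.add_apply, Pi.sub_apply]; ring
    rw [hfun, expect_add, expect_sub, expect_sub]
  have hpos : 0 ≤ expect q (fun ω => (F ω - F' ω) * (G ω - G' ω)) := by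
    rw [hexp, hEFG']
    rw [hEG'] at h2
    rw [hEF'] at h3
    linarith [h1, h2, h3]
  rw [hsum] at hpos
  exact (mul_nonneg_iff_of_pos_left (by positivity)).1 hpos

end Antipode

end TReduction

end Summit.Ventures.PercRepro2
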